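import Summits.QuantumFields.YangMills.Theorems.UnitScaleTiltCoverSites
import HarnessLib

/-!
# Route `UnitScaleTilt`, crux K1 «MinimiserStabilityRegPr» (stmt-QuantumFields-19200), leaf `stub_halvingStep` — the (P2-small) branch by COVERING
# (★★OWNER RULING g26-№18 (α), brick α1 part 3): **OFFSETS, BLOCK SITES AND STRAIGHT SEGMENTS UNDER THE COVERING MAP `π`**
# (LEAD `ym-ust-19200-w5` g3's α3b instantiation inputs 08:40:47Z∕08:42:04Z: `proj_blockSite`, the offset `val_proj_mod_L`, `segSum_comp_projBond`)

Cell `ym3-torus` (HUMAN RULING D-0037, YM ladder rung R3 — continuum SU(2) YM₃ on the torus is a RUNG, not the Clay problem), explicit-unit helper seat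
`ym-ust-19936-w8` gen 0.  Def-free; `--supports stmt-QuantumFields-19200 --as helper`; counts toward nothing by itself.  A separate file only because of the
400-line rule (✓α1 `…CoverSites` = 369 l.).

WHY.  LEAD's generic α3b (`…CoverAverages`) transports the linear block averages `Q`∕`Q′` (`bondAvgIter`∕`siteAvgIter`, defined over the offset
parametrisation `Site.blockSite y r` and the straight segments `segSum`) along a level-indexed map `φ` under three hypotheses: `φ` commutes with `shift`
(✓`proj_shift`), with `blockSite` (`proj_blockSite` here), and preserves the offset `x_μ mod L` (`val_proj_mod_L` here); the pullback of a segment sum is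
`segSum_comp_projBond`.  This file discharges them for α1's `proj`.

WHAT IS PROVED (namespace `…Theorems.CoverSites`): `val_proj_mod_L`, ★`proj_blockSite` (+ `_of_eq`), `proj_runSite`, `projBond_runBond`, ★`segSum_comp_projBond`.
HONEST SCOPE: `ZMod`∕`Nat.mod` bookkeeping; NOT a claim about the mass gap.

References: T. Bałaban, CMP **109** (1987) 249–301 [Balaban1987RG1] ((0.1)–(0.3) pp.251–252 — blocks and their sites); CMP **95** (1984) 17–40
[Balaban1984PropagatorsI] ((1.7)–(1.8) pp.18–19 — straight contours and `A(Γ)`).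
-/

open scoped BigOperators

namespace Summit.QuantumFields.YangMills.Theorems.CoverSites

open Literature.MathematicalPhysics.QuantumFieldTheory.Balaban1983to89

variable (P : Params) (jc : ℕ)

/-! ## §1 Offsets, block sites and straight segments under `π` -/

section Blocks

open LatticeFieldCalculus (runSite runBond segSum)

/-- **`π` PRESERVES THE OFFSET IN A BLOCK**: `(π x)_μ mod L = x_μ mod L` for `i + 1 ≤ m + K` (because `L ∣ 2L^{m+K−i}`). [cite: Balaban1987RG1, (0.3) p.252] -/
theorem val_proj_mod_L (i : ℕ) (hi : i + 1 ≤ P.m + P.K) (x : Site (cover P jc) i) (μ : Fin P.d) :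
    (proj P jc i x μ).val % P.L = (x μ).val % P.L := by
  rw [val_proj, sitesPerDir_eq_mul_succ P i hi]
  exact Nat.mod_mod_of_dvd _ (dvd_mul_right P.L _)

/-- **BLOCK SITES COMMUTE WITH `π`**: `π (blockSite ỹ r) = blockSite (π ỹ) r` — the fine site with offset `r` of the block over `ỹ` projects to the fine site
with the SAME offset of the block over `π ỹ` (`(ỹ mod 2L^{a})·L + r ≡ ỹ·L + r (mod L·2L^{a})`; standing range `i + 1 ≤ m + K`). [cite: Balaban1987RG1, (0.3) p.252] -/
theorem proj_blockSite (i : ℕ) (hi : i + 1 ≤ P.m + P.K) (yt : Site (cover P jc) (i + 1)) (r : Fin P.d → Fin P.L) :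
    proj P jc i (Site.blockSite yt r) = Site.blockSite (proj P jc (i + 1) yt) r := by
  funext μ
  rw [proj_apply]
  unfold Site.blockSite
  rw [map_natCast, val_proj, ZMod.natCast_eq_natCast_iff, sitesPerDir_eq_mul_succ P i hi, mul_comm P.L]
  exact Nat.ModEq.add_right _ (Nat.ModEq.mul_right' _ (Nat.mod_modEq _ _)).symm

/-- straight contours commute with `π`: `π (x + t·e_μ) = π x + t·e_μ`. [cite: Balaban1984PropagatorsI, (1.7) p.18] -/
theorem proj_runSite (i : ℕ) (x : Site (cover P jc) i) (μ : Fin P.d) (t : ℕ) :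
    proj P jc i (runSite x μ t) = runSite (proj P jc i x) μ t := by
  funext ν
  show ZMod.castHom (sitesPerDir_dvd P jc i) (ZMod (P.sitesPerDir i)) (Function.update x μ (x μ + t) ν) =
    Function.update (proj P jc i x) μ (proj P jc i x μ + t) ν
  by_cases h : ν = μ
  · subst h
    rw [Function.update_self, Function.update_self, map_add, map_natCast, proj_apply]
  · rw [Function.update_of_ne h, Function.update_of_ne h, proj_apply]

/-- the bonds of a straight contour project to the bonds of the projected contour. [cite: Balaban1984PropagatorsI, (1.7) p.18] -/
theorem projBond_runBond (i : ℕ) (x : Site (cover P jc) i) (μ : Fin P.d) (t : ℕ) :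
    projBond P jc i (runBond x μ t) = runBond (proj P jc i x) μ t := by
  rw [runBond, runBond, projBond, proj_runSite]

/-- **STRAIGHT-SEGMENT SUMS OF A PULLED-BACK BOND FIELD**: `(A ∘ π)([x̃, x̃ + n e_μ]) = A([π x̃, π x̃ + n e_μ])`. [cite: Balaban1984PropagatorsI, (1.8) p.19] -/
theorem segSum_comp_projBond {V : Type*} [AddCommGroup V] (i : ℕ) (A : VecField P i V) (xt : Site (cover P jc) i) (μ : Fin P.d) (n : ℕ) :
    segSum (fun bt => A (projBond P jc i bt)) xt μ n = segSum A (proj P jc i xt) μ n := by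
  unfold segSum
  exact Finset.sum_congr rfl fun t _ => by simp only [projBond_runBond]

/-- block sites of the cover with a given image: `π (blockSite ỹ r) = blockSite y r` whenever `π ỹ = y` (the form α3b's fibre bijection
`(ỹ, r) ↦ blockSite ỹ r` uses). [cite: Balaban1987RG1, (0.3) p.252] -/
theorem proj_blockSite_of_eq (i : ℕ) (hi : i + 1 ≤ P.m + P.K) {yt : Site (cover P jc) (i + 1)} {y : Site P (i + 1)}
    (h : proj P jc (i + 1) yt = y) (r : Fin P.d → Fin P.L) : proj P jc i (Site.blockSite yt r) = Site.blockSite y r := by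
  rw [proj_blockSite P jc i hi, h]


/-- `proj_blockSite` in the CAST SHAPE of LEAD's generic α3b (`…CoverAverages`, hypothesis `hblk` for a family `φ i : Site P′ i → Site P i` with
`hd : P′.d = P.d`, `hL : P′.L = P.L`): for the cover both equations are `rfl` and the `arrowCongr`-cast of the offset vector is the offset vector.
[cite: Balaban1987RG1, (0.3) p.252] -/
theorem proj_blockSite_cast (i : ℕ) (hi : i + 1 ≤ P.m + P.K) (hd : (cover P jc).d = P.d) (hL : (cover P jc).L = P.L)
    (yt : Site (cover P jc) (i + 1)) (r : Fin (cover P jc).d → Fin (cover P jc).L) :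
    proj P jc i (Site.blockSite yt r) = Site.blockSite (proj P jc (i + 1) yt) ((Equiv.arrowCongr (finCongr hd) (finCongr hL)) r) := by
  rw [proj_blockSite P jc i hi]
  congr 1

/-- `proj_shift` in the CAST SHAPE of LEAD's generic α3a∕α3b (hypothesis `hs : φ i (x.shift μ) = (φ i x).shift (Fin.cast hd μ)`). [cite: Balaban1987RG1, (0.1) p.251] -/
theorem proj_shift_cast (i : ℕ) (hd : (cover P jc).d = P.d) (x : Site (cover P jc) i) (μ : Fin (cover P jc).d) :
    proj P jc i (x.shift μ) = (proj P jc i x).shift (Fin.cast hd μ) :=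
  proj_shift P jc i x μ

/-- `proj_unshift` in the cast shape. [cite: Balaban1987RG1, (0.1) p.251] -/
theorem proj_unshift_cast (i : ℕ) (hd : (cover P jc).d = P.d) (x : Site (cover P jc) i) (μ : Fin (cover P jc).d) :
    proj P jc i (x.unshift μ) = (proj P jc i x).unshift (Fin.cast hd μ) :=
  proj_unshift P jc i x μ

end Blocks

end Summit.QuantumFields.YangMills.Theorems.CoverSites
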